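import Mathlib
import Literature.AlgebraicGeometry.Motives.ProjClosedFractions
import Literature.AlgebraicGeometry.Motives.VarietiesProjectiveSpaceProofs
import Literature.AlgebraicGeometry.Resolution.ProjectiveModelsCharts
import Literature.AlgebraicGeometry.Resolution.AffineDomainDimension

/-!
# TropicalLinks / SchonResolves — an integral closed subscheme of `ℙⁿ_k` as a very affine model

Route `ResolutionOfSingularities/TropicalLinks`, crux `SchonResolves` (stmt-ResolutionOfSingularities-17234),
line `zariski-toric-closure`, stub `stub_veryAffineModel` (Step B of Tevelev's "schön ⇒ resolution").

For an integral closed subscheme `ι : X ↪ ℙⁿ_k` we produce: the function field `K = K(X)` with its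
`k`-algebra structure (constants pulled back along `X → ℙⁿ_k → Spec k`), `X` as a projective model
`MX` of `K/k` (`ProjModel.ofChart` on the affine chart `X ∩ D₊(x_{j₀})`, `j₀` a coordinate not
vanishing on `X`, with `j₀ = 0` whenever `x₀` does not vanish on `X`), the rational functions
`τ_j = x_j/x_{j₀} ∈ K` of the coordinates (`ProjFrac.dehomFn`; replaced by `1` for the coordinates
vanishing identically on `X`, so that all `τ_j` are units and `τ₀ = 1`), the Laurent evaluation
`ev : k[ℤⁿ] →ₐ[k] K`, `x^v ↦ ∏ τ_{l+1}^{v_l}` (so `ev (x^{e_j - e_i}) = τ_j/τ_i`), and the standard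
charts `C i = k[τ_j/τ_i : j] ⊆ K`.  The kernel of `ev` is prime and `k[ℤⁿ]/ker ev` is an affine
domain (`dim ∈ ℕ`, tree `exists_ringKrullDim_eq_and_trdeg_eq`); `K = Frac Γ(X ∩ D₊(x_{j₀}))` is
the fraction field of the image of `ev`; and `C i` contains the image of the coordinate ring
`Γ(X ∩ D₊(x_c))` (`c = i`, or `c = j₀` when `x_i` vanishes on `X`) — every regular function there
is `G(x)/x_c^m = G(τ/τ_c)` (`ProjFrac.fracFn_mk_eq_div`, Euler's identity) — which gives the
`k`-morphisms `Spec (C i) → Spec Γ(X ∩ D₊(x_c)) ↪ X` through which the generic point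
`Spec K → X` factors (Hartshorne I Ex. 2.9, II Prop. 2.5(b); Görtz–Wedhorn I, (13.4)).
Standard material; no new definitions.
-/

-- single-problem summit: the doubled namespace component `ResolutionOfSingularities` is forced
set_option linter.dupNamespace false

namespace Summit.ResolutionOfSingularities.ResolutionOfSingularities.Theorems

open CategoryTheory AlgebraicGeometry TopologicalSpace Opposite HomogeneousLocalization
open Literature.AlgebraicGeometry.Motives Literature.AlgebraicGeometry.Motives.RatFn
open Literature.AlgebraicGeometry.Motives.ProjFrac Literature.AlgebraicGeometry.Morphisms.ProjCech
open Literature.AlgebraicGeometry.Resolution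

-- Mathlib's non-instance grading of `k[x₀,…,xₙ]` and the tree's `k`-algebra structure on its
-- homogeneous localisations: the local instances under which the `ProjFrac` dictionary
-- (`Motives/ProjClosedFractions`) is stated; neither overrides a library instance.
attribute [local instance] MvPolynomial.gradedAlgebra ProjBaseChange.algebraBase

universe u

/-! ## Bookkeeping: affine opens over `Spec R`, the Laurent evaluation -/

/-- For an affine open `U ⊆ X` of a scheme over `Spec R`, the composite
`Spec Γ(X, U) → X → Spec R` is `Spec` of `R → Γ(X, ⊤) → Γ(X, U)`. [folklore] -/
theorem schonResolves_fromSpec_comp {X : Scheme.{u}} {U : X.Opens} (hU : IsAffineOpen U)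
    {R : CommRingCat.{u}} (f : X ⟶ Spec R) :
    hU.fromSpec ≫ f =
      Spec.map ((Scheme.ΓSpecIso R).inv ≫ f.appTop ≫ X.presheaf.map (homOfLE le_top).op) := by
  have hf : f = X.toSpecΓ ≫ Spec.map ((Scheme.ΓSpecIso R).inv ≫ f.appTop) := by
    rw [Spec.map_comp, ← Scheme.toSpecΓ_naturality_assoc, toSpecΓ_SpecMap_ΓSpecIso_inv,
      Category.comp_id]
  calc hU.fromSpec ≫ f
      = hU.fromSpec ≫ X.toSpecΓ ≫ Spec.map ((Scheme.ΓSpecIso R).inv ≫ f.appTop) := by rw [← hf]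
    _ = _ := by rw [IsAffineOpen.fromSpec_toSpecΓ_assoc, ← Spec.map_comp, Category.assoc]

/-- **The Laurent evaluation of a tuple of units.** For `τ : Fin (n+1) → K` with `τ₀ = 1` and
all `τ_j ≠ 0` there is a `k`-algebra map `ev : k[ℤⁿ] → K` with `ev (x^{e_j - e_i}) = τ_j / τ_i`,
where `e₀ = 0` and `e_{l+1}` is the `l`-th basis vector (`x^v ↦ ∏ τ_{l+1}^{v_l}`). [folklore] -/
theorem schonResolves_exists_laurentEval {k K : Type*} [Field k] [Field K] [Algebra k K] {n : ℕ}
    (τ : Fin (n + 1) → K) (h0 : τ 0 = 1) (hτ : ∀ j, τ j ≠ 0) :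
    ∃ ev : AddMonoidAlgebra k (Fin n → ℤ) →ₐ[k] K, ∀ i j : Fin (n + 1),
      ev (AddMonoidAlgebra.single
        (Fin.cases (0 : Fin n → ℤ) (fun l : Fin n => (Pi.single l 1 : Fin n → ℤ)) j -
          Fin.cases (0 : Fin n → ℤ) (fun l : Fin n => (Pi.single l 1 : Fin n → ℤ)) i) (1 : k)) =
        τ j / τ i := by
  classical
  let F : Multiplicative (Fin n → ℤ) →* K :=
    { toFun := fun v => ∏ l, τ l.succ ^ (Multiplicative.toAdd v l)
      map_one' := by simp
      map_mul' := fun v w => by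
        simp only [toAdd_mul, Pi.add_apply, ← Finset.prod_mul_distrib]
        exact Finset.prod_congr rfl fun l _ => zpow_add₀ (hτ l.succ) _ _ }
  have hE : ∀ j : Fin (n + 1),
      F (Multiplicative.ofAdd
        (Fin.cases (0 : Fin n → ℤ) (fun l : Fin n => (Pi.single l 1 : Fin n → ℤ)) j)) = τ j := by
    intro j
    refine Fin.cases ?_ (fun l => ?_) j
    · simp [F, h0]
    · simp only [F, MonoidHom.coe_mk, OneHom.coe_mk, toAdd_ofAdd, Fin.cases_succ]
      rw [Finset.prod_eq_single l (fun l' _ hl' => by rw [Pi.single_eq_of_ne hl', zpow_zero])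
        (fun h => absurd (Finset.mem_univ l) h), Pi.single_eq_same, zpow_one]
  refine ⟨AddMonoidAlgebra.lift k K (Fin n → ℤ) F, fun i j => ?_⟩
  rw [AddMonoidAlgebra.lift_single, one_smul, ofAdd_sub, map_div, hE, hE]

/-! ## Rational functions on a closed subscheme of `ℙⁿ_k` -/

section Charts

variable {k : Type u} [Field k] {n : ℕ} {X : Scheme.{u}} [IsIntegral X] (ι : X ⟶ PP k n)

/-- Some coordinate `x_j` does not vanish identically on `X` (the `D₊(x_j)` cover `ℙⁿ_k`).
[folklore] -/
theorem schonResolves_exists_genericPoint_mem_ZH :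
    ∃ j : Fin (n + 1), genericPoint X ∈ ZH ι (MvPolynomial.X j) := by
  obtain ⟨s, y, hy⟩ := (ProjectiveSpace.chartCover n k).exists_eq (ι (genericPoint X))
  refine ⟨s, ?_⟩
  change ι (genericPoint X) ∈ Proj.basicOpen (grading k n) (MvPolynomial.X s)
  rw [← ProjectiveSpace.opensRange_chartCover_f n k s]
  exact ⟨y, hy⟩

variable {ι}

/-- **`x_j/x_{j₀} = 0` in `K(X)` when `x_j` vanishes identically on `X`** (its basic open
`X ∩ D₊(x_j x_{j₀})` would otherwise contain the generic point). [folklore] -/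
theorem schonResolves_dehomFn_X_eq_zero {j₀ j : Fin (n + 1)}
    (hj₀ : genericPoint X ∈ ZH ι (MvPolynomial.X j₀))
    (hj : genericPoint X ∉ ZH ι (MvPolynomial.X j)) :
    dehomFn ι j₀ hj₀ (MvPolynomial.X j) = 0 := by
  by_contra h
  apply hj
  have heq :
      Away.isLocalizationElem (ProjectiveSpace.X_mem (R := k) j₀) (ProjectiveSpace.X_mem j) =
        Away.mk (grading k n) (ProjectiveSpace.X_mem j₀) 1 (MvPolynomial.X j)
        (by simpa using ProjectiveSpace.X_mem (R := k) j) := by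
    rw [ProjectiveSpace.isLocalizationElem_X, ProjectiveSpace.toChart_dehomogenize j₀ _
      (ProjectiveSpace.X_mem j)]
  have hmem : genericPoint X ∈ X.basicOpen (evalAway ι (MvPolynomial.X j₀)
      (Away.isLocalizationElem (ProjectiveSpace.X_mem (R := k) j₀)
        (ProjectiveSpace.X_mem j))) := by
    rw [genericPoint_mem_basicOpen_iff hj₀, heq, ← fracFn_apply,
      ← dehomFn_of_mem ι j₀ hj₀ (ProjectiveSpace.X_mem j)]
    exact h
  rw [← ZH_mul_eq_basicOpen_evalAway ι (ProjectiveSpace.X_mem j₀) one_pos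
    (ProjectiveSpace.X_mem j) one_pos, ZH_mul] at hmem
  exact hmem.2

/-- `x_{j₀}/x_{j₀} = 1` in `K(X)`. [folklore] -/
theorem schonResolves_dehomFn_X_self {j₀ : Fin (n + 1)}
    (hj₀ : genericPoint X ∈ ZH ι (MvPolynomial.X j₀)) :
    dehomFn ι j₀ hj₀ (MvPolynomial.X j₀) = 1 := by
  rw [dehomFn, RingHom.comp_apply, dehomAway, RingHom.comp_apply, AlgHom.toRingHom_eq_coe,
    AlgHom.toRingHom_eq_coe, RingHom.coe_coe, RingHom.coe_coe, ProjectiveSpace.dehomogenize_X_self,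
    map_one, map_one]

/-- **The constants of `dehomFn`**: `dehomFn (C a)` is the rational function of the global function
`a` pulled back along `X → ℙⁿ_k → Spec k`. [folklore] -/
theorem schonResolves_dehomFn_C {j₀ : Fin (n + 1)}
    (hj₀ : genericPoint X ∈ ZH ι (MvPolynomial.X j₀)) (a : k) :
    dehomFn ι j₀ hj₀ (MvPolynomial.C a) = X.presheaf.germ ⊤ (genericPoint X) trivial
      ((ι ≫ toSpec k n).appTop ((Scheme.ΓSpecIso (.of k)).inv a)) := by
  rw [dehomFn, RingHom.comp_apply, dehomAway_C, fracFn_apply,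
    evalAway_algebraMap ι (ProjectiveSpace.X_mem j₀) one_pos, ofSection_map]

variable [Algebra k X.functionField]

/-- **Regular functions on `X ∩ D₊(x_c)` are polynomials in the `x_j/x_c`**: for `k`-linear
`dehomFn` (hypothesis `halg`), the rational function of a degree-zero fraction `G/x_c^m` lies in
`k[(x_j/x_{j₀})/(x_c/x_{j₀}) : j]` (`G(x)/x_c^m = G(x/x_{j₀})/(x_c/x_{j₀})^m = G(τ_j/τ_c)` by
Euler's identity for the homogeneous `G`). [folklore] -/
theorem schonResolves_fracFn_mem_adjoin {j₀ c : Fin (n + 1)}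
    (hj₀ : genericPoint X ∈ ZH ι (MvPolynomial.X j₀))
    (hc : genericPoint X ∈ ZH ι (MvPolynomial.X c))
    (halg : ∀ a : k, algebraMap k X.functionField a = dehomFn ι j₀ hj₀ (MvPolynomial.C a))
    (a : Away (grading k n) (MvPolynomial.X c)) :
    fracFn ι (MvPolynomial.X c) hc a ∈ Algebra.adjoin k (Set.range fun j : Fin (n + 1) =>
      dehomFn ι j₀ hj₀ (MvPolynomial.X j) / dehomFn ι j₀ hj₀ (MvPolynomial.X c)) := by
  obtain ⟨m, G, hG, rfl⟩ := Away.mk_surjective (grading k n) (ProjectiveSpace.X_mem c) a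
  rw [fracFn_mk_eq_div ι hj₀ (ProjectiveSpace.X_mem c) one_pos hc m hG]
  have hev : dehomFn ι j₀ hj₀ =
      (MvPolynomial.aeval fun j => dehomFn ι j₀ hj₀ (MvPolynomial.X j)).toRingHom :=
    MvPolynomial.ringHom_ext (fun a => by rw [← halg]; exact (AlgHom.commutes _ a).symm)
      (fun j => by simp)
  have hGm : G.IsHomogeneous m := by simpa using hG
  have key : dehomFn ι j₀ hj₀ G / dehomFn ι j₀ hj₀ (MvPolynomial.X c) ^ m =
      MvPolynomial.aeval (fun j => dehomFn ι j₀ hj₀ (MvPolynomial.X j) /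
        dehomFn ι j₀ hj₀ (MvPolynomial.X c)) G := by
    have h := ProjectiveSpace.isHomogeneous_aeval_const_mul hGm
      (dehomFn ι j₀ hj₀ (MvPolynomial.X c))⁻¹ (fun j => dehomFn ι j₀ hj₀ (MvPolynomial.X j))
    simp only [← div_eq_inv_mul] at h
    rw [h, div_eq_mul_inv, ← inv_pow, mul_comm]
    congr 1
    exact congrArg (fun φ : MvPolynomial (Fin (n + 1)) k →+* X.functionField => φ G) hev
  rw [key, Algebra.adjoin_range_eq_range_aeval]
  exact ⟨G, rfl⟩

omit [Algebra k X.functionField] in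
/-- **The standard chart morphisms.** If the `k`-algebra structure of `K(X)` is by pull-back of
constants along `πX : X → Spec k` and a subalgebra `C ⊆ K(X)` contains the rational functions of
all degree-zero fractions `G/x_c^m` (`x_c` not vanishing on `X`), then
`Spec C → Spec Γ(X ∩ D₊(x_c)) ↪ X` is a `k`-morphism through which `Spec K(X) → X` factors.
[folklore] -/
theorem schonResolves_exists_chartHom [IsClosedImmersion ι] [Algebra k X.functionField]
    (πX : X ⟶ Spec (.of k))
    (halgK : ∀ a : k, algebraMap k X.functionField a =
      X.presheaf.germ ⊤ (genericPoint X) trivial (πX.appTop ((Scheme.ΓSpecIso (.of k)).inv a)))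
    {c : Fin (n + 1)} (hc : genericPoint X ∈ ZH ι (MvPolynomial.X c))
    (C : Subalgebra k X.functionField) (hC : ∀ a, fracFn ι (MvPolynomial.X c) hc a ∈ C) :
    ∃ g : Spec (CommRingCat.of C) ⟶ X,
      g ≫ πX = Spec.map (CommRingCat.ofHom (algebraMap k C)) ∧
      Spec.map (CommRingCat.ofHom C.val.toRingHom) ≫ g = X.fromSpecStalk (genericPoint X) := by
  have hU : IsAffineOpen (ZH ι (MvPolynomial.X c)) :=
    isAffineOpen_ZH ι (ProjectiveSpace.X_mem c) one_pos
  haveI : Nonempty (ZH ι (MvPolynomial.X c)) := ⟨⟨_, hc⟩⟩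
  have hrange : ∀ s : Γ(X, ZH ι (MvPolynomial.X c)),
      (X.germToFunctionField (ZH ι (MvPolynomial.X c))).hom s ∈ C.toSubring := by
    intro s
    obtain ⟨a, rfl⟩ := evalAway_surjective ι (ProjectiveSpace.X_mem c) one_pos s
    exact hC a
  let ψ : Γ(X, ZH ι (MvPolynomial.X c)) →+* C :=
    (X.germToFunctionField (ZH ι (MvPolynomial.X c))).hom.codRestrict C.toSubring hrange
  refine ⟨Spec.map (CommRingCat.ofHom ψ) ≫ hU.fromSpec, ?_, ?_⟩
  · rw [Category.assoc, schonResolves_fromSpec_comp hU πX, ← Spec.map_comp]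
    congr 1
    ext a : 2
    apply Subtype.ext
    change X.germToFunctionField (ZH ι (MvPolynomial.X c))
      (X.presheaf.map (homOfLE le_top).op (πX.appTop ((Scheme.ΓSpecIso (.of k)).inv a))) =
      algebraMap k X.functionField a
    rw [halgK]
    exact TopCat.Presheaf.germ_res_apply X.presheaf _ _ _ _
  · rw [← Spec.map_comp_assoc, ← CommRingCat.ofHom_comp]
    have hcomp : C.val.toRingHom.comp ψ = (X.germToFunctionField (ZH ι (MvPolynomial.X c))).hom :=
      RingHom.ext fun s => rfl
    rw [hcomp, CommRingCat.ofHom_hom, ← hU.fromSpecStalk_eq_fromSpecStalk hc]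
    rfl

end Charts

/-! ## The very affine model -/

/-- **An integral closed subscheme of `𝐏ⁿ_k` is a very affine projective model of its function
field** (the `ProjCech.PP` spelling of `stub_veryAffineModel`; see the module docstring).
[folklore] -/
theorem schonResolves_veryAffineModel_PP {k : Type} [Field k] {n : ℕ} (X : Scheme.{0})
    [IsIntegral X] (ι : X ⟶ PP k n) [IsClosedImmersion ι] :
    ∃ (K : Type) (_ : Field K) (_ : Algebra k K) (MX : ProjModel k K) (_ : MX.X ≅ X) (M d : ℕ)
      (ev : AddMonoidAlgebra k (Fin M → ℤ) →ₐ[k] K) (C : Fin (M + 1) → Subalgebra k K),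
      (RingHom.ker ev.toRingHom).IsPrime ∧
      ringKrullDim (AddMonoidAlgebra k (Fin M → ℤ) ⧸ RingHom.ker ev.toRingHom) =
        (d : WithBot ℕ∞) ∧
      (∀ z : K, ∃ a b : AddMonoidAlgebra k (Fin M → ℤ), ev b ≠ 0 ∧ z * ev b = ev a) ∧
      (∀ i : Fin (M + 1), C i = Algebra.adjoin k (Set.range fun j : Fin (M + 1) =>
        ev (AddMonoidAlgebra.single
          (Fin.cases (0 : Fin M → ℤ) (fun l : Fin M => (Pi.single l 1 : Fin M → ℤ)) j -
            Fin.cases (0 : Fin M → ℤ) (fun l : Fin M => (Pi.single l 1 : Fin M → ℤ)) i)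
          (1 : k)))) ∧
      ∀ i : Fin (M + 1), ∃ g : Spec (CommRingCat.of (C i)) ⟶ MX.X,
        g ≫ MX.π = Spec.map (CommRingCat.ofHom (algebraMap k (C i))) ∧
        Spec.map (CommRingCat.ofHom (C i).val.toRingHom) ≫ g = MX.gen := by
  classical
  -- a coordinate `x_{j₀}` not vanishing on `X`, with `j₀ = 0` if possible
  obtain ⟨j₀, hj₀, hj₀0⟩ : ∃ j₀ : Fin (n + 1), genericPoint X ∈ ZH ι (MvPolynomial.X j₀) ∧
      (genericPoint X ∈ ZH ι (MvPolynomial.X 0) → j₀ = 0) := by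
    by_cases h0 : genericPoint X ∈ ZH ι (MvPolynomial.X 0)
    · exact ⟨0, h0, fun _ => rfl⟩
    · obtain ⟨j, hj⟩ := schonResolves_exists_genericPoint_mem_ZH ι
      exact ⟨j, hj, fun h => absurd h h0⟩
  -- `X` over `k`, and the `k`-algebra structure of `K(X)` by pull-back of constants
  let πX : X ⟶ Spec (.of k) := ι ≫ toSpec k n
  have hproj : IsProjectiveOver (Over.mk πX) := ⟨n, Over.homMk ι rfl, ‹_›⟩
  letI algK : Algebra k X.functionField :=
    ((X.presheaf.germ ⊤ (genericPoint X) trivial).hom.comp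
      (πX.appTop.hom.comp (Scheme.ΓSpecIso (.of k)).inv.hom)).toAlgebra
  have halgK : ∀ a : k, algebraMap k X.functionField a = X.presheaf.germ ⊤ (genericPoint X)
      trivial (πX.appTop ((Scheme.ΓSpecIso (.of k)).inv a)) :=
    fun a => rfl
  have halg : ∀ a : k,
      algebraMap k X.functionField a = dehomFn ι j₀ hj₀ (MvPolynomial.C a) :=
    fun a => (schonResolves_dehomFn_C hj₀ a).symm
  -- the affine chart `A = Γ(X ∩ D₊(x_{j₀}))`, `Frac A = K(X)`, and `X` as a projective model
  have hU : IsAffineOpen (ZH ι (MvPolynomial.X j₀)) :=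
    isAffineOpen_ZH ι (ProjectiveSpace.X_mem j₀) one_pos
  haveI : Nonempty (ZH ι (MvPolynomial.X j₀)) := ⟨⟨_, hj₀⟩⟩
  letI algA : Algebra k Γ(X, ZH ι (MvPolynomial.X j₀)) :=
    ((X.presheaf.map (homOfLE (le_top : ZH ι (MvPolynomial.X j₀) ≤ ⊤)).op).hom.comp
      (πX.appTop.hom.comp (Scheme.ΓSpecIso (.of k)).inv.hom)).toAlgebra
  haveI : IsScalarTower k Γ(X, ZH ι (MvPolynomial.X j₀)) X.functionField :=
    IsScalarTower.of_algebraMap_eq fun a =>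
      (TopCat.Presheaf.germ_res_apply X.presheaf (homOfLE le_top) _ hj₀ _).symm
  haveI : IsFractionRing Γ(X, ZH ι (MvPolynomial.X j₀)) X.functionField :=
    functionField_isFractionRing_of_isAffineOpen X _ hU
  have hj : hU.fromSpec ≫ πX =
      Spec.map (CommRingCat.ofHom (algebraMap k Γ(X, ZH ι (MvPolynomial.X j₀)))) := by
    rw [schonResolves_fromSpec_comp hU πX]
    rfl
  have hgen : (ProjModel.ofChart (K := X.functionField) X πX hproj
      Γ(X, ZH ι (MvPolynomial.X j₀)) hU.fromSpec hj).gen = X.fromSpecStalk (genericPoint X) := by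
    rw [ProjModel.ofChart_gen, ← hU.fromSpecStalk_eq_fromSpecStalk hj₀]
    rfl
  -- the units `τ_j` (`x_j/x_{j₀}`, or `1` where `x_j` vanishes on `X`), the Laurent evaluation
  let τ : Fin (n + 1) → X.functionField := fun j =>
    if genericPoint X ∈ ZH ι (MvPolynomial.X j) then dehomFn ι j₀ hj₀ (MvPolynomial.X j)
    else 1
  have hτ : ∀ j, genericPoint X ∈ ZH ι (MvPolynomial.X j) →
      τ j = dehomFn ι j₀ hj₀ (MvPolynomial.X j) := fun j hj => if_pos hj
  have hτ' : ∀ j, genericPoint X ∉ ZH ι (MvPolynomial.X j) → τ j = 1 :=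
    fun j hj => if_neg hj
  have hτj₀ : τ j₀ = 1 := by rw [hτ j₀ hj₀, schonResolves_dehomFn_X_self hj₀]
  have hτ0 : τ 0 = 1 := by
    by_cases h0 : genericPoint X ∈ ZH ι (MvPolynomial.X 0)
    · have := hj₀0 h0
      subst this
      exact hτj₀
    · exact hτ' 0 h0
  have hτne : ∀ j, τ j ≠ 0 := by
    intro j
    by_cases hj : genericPoint X ∈ ZH ι (MvPolynomial.X j)
    · rw [hτ j hj]
      exact dehomFn_ne_zero ι hj₀ (ProjectiveSpace.X_mem j) one_pos hj
    · rw [hτ' j hj]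
      exact one_ne_zero
  obtain ⟨ev, hev⟩ := schonResolves_exists_laurentEval (k := k) τ hτ0 hτne
  -- dimension of the very affine coordinate ring (an affine domain)
  haveI : AddMonoid.FG (Fin n → ℤ) :=
    AddGroup.fg_iff_addMonoid_fg.1 (Module.Finite.iff_addGroup_fg.1 inferInstance)
  haveI hprime : (RingHom.ker ev.toRingHom).IsPrime := RingHom.ker_isPrime _
  obtain ⟨d, hd, -⟩ := exists_ringKrullDim_eq_and_trdeg_eq k
    (AddMonoidAlgebra k (Fin n → ℤ) ⧸ RingHom.ker ev.toRingHom)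
  -- the chart rings `C i = k[τ_j/τ_i]` contain the coordinate rings `Γ(X ∩ D₊(x_c))`
  have hgen_mem : ∀ i j : Fin (n + 1), dehomFn ι j₀ hj₀ (MvPolynomial.X j) / τ i ∈
      Algebra.adjoin k (Set.range fun j : Fin (n + 1) => ev (AddMonoidAlgebra.single
        (Fin.cases (0 : Fin n → ℤ) (fun l : Fin n => (Pi.single l 1 : Fin n → ℤ)) j -
          Fin.cases (0 : Fin n → ℤ) (fun l : Fin n => (Pi.single l 1 : Fin n → ℤ)) i)
        (1 : k))) := by
    intro i j
    by_cases hj : genericPoint X ∈ ZH ι (MvPolynomial.X j)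
    · rw [← hτ j hj, ← hev i j]
      exact Algebra.subset_adjoin ⟨j, rfl⟩
    · rw [schonResolves_dehomFn_X_eq_zero hj₀ hj, zero_div]
      exact Subalgebra.zero_mem _
  have key : ∀ (i c : Fin (n + 1)) (hc : genericPoint X ∈ ZH ι (MvPolynomial.X c)),
      dehomFn ι j₀ hj₀ (MvPolynomial.X c) = τ i → ∀ a, fracFn ι (MvPolynomial.X c) hc a ∈
      Algebra.adjoin k (Set.range fun j : Fin (n + 1) => ev (AddMonoidAlgebra.single
        (Fin.cases (0 : Fin n → ℤ) (fun l : Fin n => (Pi.single l 1 : Fin n → ℤ)) j -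
          Fin.cases (0 : Fin n → ℤ) (fun l : Fin n => (Pi.single l 1 : Fin n → ℤ)) i)
        (1 : k))) := by
    intro i c hc hct a
    have h := schonResolves_fracFn_mem_adjoin hj₀ hc halg a
    rw [hct] at h
    exact Algebra.adjoin_le (by rintro _ ⟨j, rfl⟩; exact hgen_mem i j) h
  have hcontain : ∀ i : Fin (n + 1),
      ∃ (c : Fin (n + 1)) (hc : genericPoint X ∈ ZH ι (MvPolynomial.X c)),
      ∀ a, fracFn ι (MvPolynomial.X c) hc a ∈
      Algebra.adjoin k (Set.range fun j : Fin (n + 1) => ev (AddMonoidAlgebra.single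
        (Fin.cases (0 : Fin n → ℤ) (fun l : Fin n => (Pi.single l 1 : Fin n → ℤ)) j -
          Fin.cases (0 : Fin n → ℤ) (fun l : Fin n => (Pi.single l 1 : Fin n → ℤ)) i)
        (1 : k))) := by
    intro i
    by_cases hi : genericPoint X ∈ ZH ι (MvPolynomial.X i)
    · exact ⟨i, hi, key i i hi (hτ i hi).symm⟩
    · exact ⟨j₀, hj₀,
        key i j₀ hj₀ (by rw [schonResolves_dehomFn_X_self hj₀, hτ' i hi])⟩
  -- assembly (stepwise, to keep the instance unification problems small)
  refine ⟨X.functionField, inferInstance, algK, ?_⟩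
  refine ⟨ProjModel.ofChart (K := X.functionField) X πX hproj Γ(X, ZH ι (MvPolynomial.X j₀))
    hU.fromSpec hj, Iso.refl _, n, d, ev, ?_⟩
  refine ⟨fun i => Algebra.adjoin k (Set.range fun j : Fin (n + 1) =>
      ev (AddMonoidAlgebra.single
        (Fin.cases (0 : Fin n → ℤ) (fun l : Fin n => (Pi.single l 1 : Fin n → ℤ)) j -
          Fin.cases (0 : Fin n → ℤ) (fun l : Fin n => (Pi.single l 1 : Fin n → ℤ)) i) (1 : k))), ?_⟩
  refine ⟨hprime, hd, ?_, fun i => rfl, ?_⟩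
  · -- `K(X) = Frac Γ(X ∩ D₊(x_{j₀}))` is the fraction field of the image of `ev`
    intro z
    obtain ⟨a, b, hb, rfl⟩ :=
      IsFractionRing.div_surjective (A := Γ(X, ZH ι (MvPolynomial.X j₀))) z
    have hR : ∀ s : Γ(X, ZH ι (MvPolynomial.X j₀)),
        algebraMap _ X.functionField s ∈ ev.range := by
      intro s
      obtain ⟨a', ha'⟩ := evalAway_surjective ι (ProjectiveSpace.X_mem j₀) one_pos s
      have h1 : algebraMap _ X.functionField s = fracFn ι (MvPolynomial.X j₀) hj₀ a' := by
        rw [← ha']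
        rfl
      rw [h1]
      exact (Algebra.adjoin_le (by rintro _ ⟨j, rfl⟩; exact ⟨_, rfl⟩))
        (key j₀ j₀ hj₀ (hτ j₀ hj₀).symm a')
    obtain ⟨fa, hfa⟩ := (AlgHom.mem_range ev).mp (hR a)
    obtain ⟨fb, hfb⟩ := (AlgHom.mem_range ev).mp (hR b)
    have hb0 : algebraMap _ X.functionField b ≠ 0 :=
      IsFractionRing.to_map_ne_zero_of_mem_nonZeroDivisors hb
    refine ⟨fa, fb, by rwa [hfb], ?_⟩
    rw [hfa, hfb, div_mul_cancel₀ _ hb0]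
  · -- the standard charts
    intro i
    obtain ⟨c, hc, hC⟩ := hcontain i
    obtain ⟨g, hg₁, hg₂⟩ := schonResolves_exists_chartHom (ι := ι) πX halgK hc _ hC
    exact ⟨g, hg₁, hg₂.trans hgen.symm⟩

/-- **Stub B (very affine model).** An integral closed subscheme `X` of `ℙⁿ_k` is (isomorphic to
the underlying scheme of) a projective model `MX` of a field `K/k`, together with: `M, d : ℕ`, a
`k`-algebra map `ev : k[ℤ^M] → K` (the coordinates `x_i/x_0` of the surviving homogeneous
coordinates) whose kernel is a prime of dimension `d` with fraction field `K`, and the `M+1`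
standard affine charts `Spec k[x_j/x_i] → X` (subalgebras `C i` of `K`) over `k` through which the
`K`-point factors (Hartshorne I Ex. 2.9, II Prop. 2.5(b)). [folklore] -/
theorem stub_veryAffineModel :
    ∀ (k : Type) [Field k] (n : ℕ) (X : AlgebraicGeometry.Scheme.{0}) (ι : X ⟶ (Literature.AlgebraicGeometry.Motives.projectiveSpace n k).left), AlgebraicGeometry.IsClosedImmersion ι → AlgebraicGeometry.IsIntegral X → ∃ (K : Type) (_ : Field K) (_ : Algebra k K) (MX : Literature.AlgebraicGeometry.Resolution.ProjModel k K) (_ : MX.X ≅ X) (M d : ℕ) (ev : AddMonoidAlgebra k (Fin M → ℤ) →ₐ[k] K) (C : Fin (M + 1) → Subalgebra k K), (RingHom.ker ev.toRingHom).IsPrime ∧ ringKrullDim (AddMonoidAlgebra k (Fin M → ℤ) ⧸ RingHom.ker ev.toRingHom) = (d : WithBot ℕ∞) ∧ (∀ z : K, ∃ a b : AddMonoidAlgebra k (Fin M → ℤ), ev b ≠ 0 ∧ z * ev b = ev a) ∧ (∀ i : Fin (M + 1), C i = Algebra.adjoin k (Set.range fun j : Fin (M + 1) => ev (AddMonoidAlgebra.single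 (Fin.cases (0 : Fin M → ℤ) (fun l : Fin M => (Pi.single l 1 : Fin M → ℤ)) j - Fin.cases (0 : Fin M → ℤ) (fun l : Fin M => (Pi.single l 1 : Fin M → ℤ)) i) (1 : k)))) ∧ ∀ i : Fin (M + 1), ∃ g : AlgebraicGeometry.Spec (CommRingCat.of (C i)) ⟶ MX.X, g ≫ MX.π = AlgebraicGeometry.Spec.map (CommRingCat.ofHom (algebraMap k (C i))) ∧ AlgebraicGeometry.Spec.map (CommRingCat.ofHom (C i).val.toRingHom) ≫ g = MX.gen := by
  intro k _ n X ι hι hX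
  exact @schonResolves_veryAffineModel_PP k _ n X hX ι hι

end Summit.ResolutionOfSingularities.ResolutionOfSingularities.Theorems
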